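import Literature.AlgebraicGeometry.Surfaces.K3MukaiLattice
import Literature.AlgebraicGeometry.Surfaces.K3NikulinInvolution
import HarnessLib

/-!
# The cohomological McKay map `(b_* g̃^*)^H : H̃(Y′) → H̃(X)` of a Nikulin involution: push–pull
# transforms along a correspondence of surfaces, the Todd twist of `Bl₈X`, and the Beckmann–Oberdieck
# table `1 ↦ 1 − p`, `p′ ↦ 2p`, `Nᵢ ↦ p`, `D ↦ g^*D` (arXiv:2006.13899 §7.2–7.3)

Family `hodge`, layer `Literature/AlgebraicGeometry/Surfaces`. DEFINITIONS (real, with bodies) plus their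
unfolding lemmas; third part of the request `defn-MukaiLatticeK3` (crux `NikulinSerreCarrier`,
stmt-HodgeConjecture-14464: "for a Nikulin involution `ι` (IsNikulinInvolution), the cohomological McKay
map `(b_*g̃^*)^H : H̃(Y′) → H̃(X)^ι` of Bridgeland–King–Reid `Φ = b_*g̃^*` (Beckmann–Oberdieck
arXiv:2006.13899 §7.2–7.3: `1 ↦ 1−p, p ↦ 2p, N_i ↦ p, δ ↦ 4p, D ↦ g^*D` on `N^⊥`) … to TYPE the
first computations of crux ideas … bkr-kernel-lattice-certificate"). Companion of `K3MukaiLattice.lean`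
(`MukaiSpace`, `mukaiPairing`) and `K3MukaiLatticeFourierMukai.lean` (`cohomFM`).

Sources, verbatim. Beckmann–Oberdieck, *Equivariant categories of symplectic surfaces and fixed loci of
Bridgeland moduli spaces*, arXiv:2006.13899 (fetched text pp. 34–36, read 2026-08-15), §7.2: "Let
`ι : S → S` be a symplectic involution of a symplectic surface with at least one fixed point and let
`G = ℤ₂` … (ii) `S` is a K3 surface and `ι` is a Nikulin involution. The number `r` of fixed points of
`G` is 16 and 8 respectively, and in both cases the minimal resolution `S′` of `S/ℤ₂` is a K3 surface. In
the fiber diagram [`α : Z → S′`, `β : Z → S`] the map `β` is the blowup at the fixed points and `α`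
identifies `S′` with the fixed locus `Hilb²(S)^G`. By [14] (or Theorem 1.1) we have the equivalence
`Φ = β_*α^* : D^b(S′) → D^b(S)_G`. … The `Eᵢ` are the exceptional divisors of the resolution `S′` and
`δ = ½ Σᵢ Eᵢ`." §7.3 (genus-2 K3, `S` of minimal Picard rank 9, `C ∈ |𝒪(2H)|` a `g`-invariant curve
disjoint from the fixed points, `C′ = C/ℤ₂`): "The map on cohomology `H^*(S′, ℤ) → H^*(S, ℤ)` induced by
the composition `D^b(S′) →Φ D^b(S)_G → D^b(S)` is given by
`1 ↦ 1 − p, p ↦ 2p, Eᵢ ↦ p, δ ↦ 4p, C′ ↦ 2H, C′₁ ↦ H − p` where we let `p` denote the class of a point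
on both `S` and `S′`." ([14] = Bridgeland–King–Reid 2001.)

## Rendering

Notation of the crux: `X` the K3 surface with the Nikulin involution (B–O's `S`), `Y` the resolved
quotient `Y′` (B–O's `S′`), `Z = Bl₈X` with `g : Z ⟶ Y` (`g̃ = α`, degree `2`) and `b : Z ⟶ X` (`β`, the
blow-up); all three are smooth projective surfaces over `ℂ` (`Motives.IsSmoothProjective 2`), handed over
as DATA (the tree has no quotients by finite groups and no blow-ups of surfaces). On the carriers of
`K3MukaiLattice.lean` (`H̃ = MukaiSpace = H⁰ × H² × H⁴` of complex Betti cohomology, pull-backs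
`complexBetti.map`, the constructed Gysin morphisms `HodgeTheory.complexGysin μ`):
* `ppTerm`, `pushPullTransform μ hZ hX g b t : H̃(Y) →ₗ[ℂ] H̃(X)`, `v ↦ b_*(g^*v ∪ t)` with a twist
  `t ∈ H̃(Z)`: the form of the cohomological transform ("the map on cohomology induced by") of a
  Fourier–Mukai functor with kernel `𝒪_Γ`, `Γ = (g, b)(Z) ⊂ Y × X` — Grothendieck–Riemann–Roch for the
  closed embedding `(g, b)` and the projection formula turn `q ↦ p_*(q^*v · v(𝒪_Γ))` (Huybrechts Ch. 16
  Prop. 3.2 / Rem. 3.3) into `b_*(g^*v ∪ t_Z)`, `t_Z = td(Z) · g^*√td(Y)⁻¹ · b^*√td(X)⁻¹`.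
* `mckayTwist e ptZ := (1, −½ Σᵢ eᵢ, −ptZ) ∈ H̃(Z)` — the value of `t_Z` for `Z = Bl₈X → Y, X` in terms of
  the eight exceptional classes `eᵢ = [Eᵢ^Z] ∈ H²(Z(ℂ))` and the point class `ptZ`:
  `td(Z) = 1 + ½c₁(Z) + χ(𝒪_Z)[pt] = 1 − ½Σeᵢ + 2 ptZ` (`K_Z = b^*K_X + ΣEᵢ = ΣEᵢ`, Noether's formula,
  `χ(𝒪_Z) = χ(𝒪_X) = 2`), `√td(K3)⁻¹ = 1 − [pt]`, `g^*[pt_Y] = 2 ptZ` (`deg g = 2`), `b^*[pt_X] = ptZ`;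
  product `(1 − ½Σeᵢ + 2ptZ)(1 − 2ptZ)(1 − ptZ) = 1 − ½Σeᵢ − ptZ`. [folklore computation, spelled out
  so the reviewer can check it; the tree has no Todd classes, so it is DATA of the definition]
* `mckayCohomological μ hZ hX g b e ptZ := pushPullTransform … (mckayTwist e ptZ)` — B–O's
  `(β_*α^*)^H : H̃(S′) → H̃(S)`.
* PROVED unfoldings reproducing the printed table from the geometric identities one has in the Nikulin
  situation (hypotheses, each a standard fact about `Bl₈X`: `b_*1 = 1`, `b_*eᵢ = 0`, `b_*ptZ = p`,
  `g^*p′ = 2 ptZ`, `g^*Nᵢ = 2eᵢ`, `eᵢ ∪ eᵢ = −ptZ`, `eᵢ ∪ eⱼ = 0`): `mckayCohomological_one`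
  (`1 ↦ 1 − p`), `mckayCohomological_top` (`p′ ↦ 2p`), `mckayCohomological_nodal` (`Nᵢ ↦ p`, hence
  `δ ↦ 4p` by linearity), `mckayCohomological_perp` (`D ↦ g^*D := b_*g̃^*D` for `g̃^*D ⊥ eⱼ`, i.e.
  `D ∈ N^⊥`; B–O's `C′ ↦ 2H`).

## What is NOT here

The construction of `Y′ = \widetilde{X/ι}`, `Z = Bl₈X`, `g̃`, `b` from `(X, ι)`; the identification of
`pushPullTransform` with `cohomFM` of `v(𝒪_Γ)` (GRR is not in the tree); the `ι`-invariance of the image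
(`H̃(X)^ι = {v | MukaiSpace.pullback ι v = v}`); the dual action `Q` of footnote 14.

## References

* [BeckmannOberdieck2020] T. Beckmann, G. Oberdieck, arXiv:2006.13899, §7.2 (pp. 34–35), §7.3 (p. 36).
* [BridgelandKingReid2001] T. Bridgeland, A. King, M. Reid, J. AMS 14 (2001), Thm. 1.1 (`Φ = β_*α^*` is
  an equivalence; through B–O).
* [Huybrechts2016K3] D. Huybrechts, Lectures on K3 Surfaces, Ch. 16 Prop. 3.2, Remark 3.3; Ch. 9 §1.2.
* [FultonYoungTableaux1997] W. Fulton, Young Tableaux, App. B §B.1 (5)–(6) (Gysin maps, projection formula).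
* [HatcherAT2002] A. Hatcher, Algebraic Topology, §3.2 (cup product, unit, naturality).
-/

noncomputable section

open CategoryTheory
open Literature.AlgebraicTopology.SingularHomology
open Literature.AlgebraicGeometry.HodgeTheory

namespace Literature.AlgebraicGeometry.Surfaces

section PushPull

variable (μ : OrientationFamily) {Z Y X : Motives.SchemeOver ℂ}
  (hZ : Motives.IsSmoothProjective 2 Z) (hX : Motives.IsSmoothProjective 2 X) (g : Z ⟶ Y) (b : Z ⟶ X)

/-! ### Push–pull transforms along a correspondence of surfaces -/

/-- **One graded piece of `b_*(g^*(–) ∪ t)`**: `H^{2i}(Y(ℂ)) → H^{2j}(X(ℂ))`, `x ↦ b_*(g^*x ∪ t_k)` for a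
twist class `t_k ∈ H^{2k}(Z(ℂ))`, `i + k = j` (`b_*` between surfaces preserves degrees).
[cite: BeckmannOberdieck2020, §7.2] [cite: FultonYoungTableaux1997, Appendix B §B.1 (5)] -/
def ppTerm (i k j : ℕ) (h : i + k = j) (tk : complexBetti Z (2 * k)) :
    complexBetti Y (2 * i) →ₗ[ℂ] complexBetti X (2 * j) :=
  complexGysin μ hZ hX b (rfl : 2 * j + 2 * 2 = 2 * j + 2 * 2) ∘ₗ
    (cupProduct (show 2 * i + 2 * k = 2 * j by omega)).flip tk ∘ₗ (complexBetti.map g (2 * i)).hom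

/-- Unfolding `ppTerm`: `x ↦ b_*(g^*x ∪ t_k)`. [cite: BeckmannOberdieck2020, §7.2] -/
theorem ppTerm_apply (i k j : ℕ) (h : i + k = j) (tk : complexBetti Z (2 * k))
    (x : complexBetti Y (2 * i)) :
    ppTerm μ hZ hX g b i k j h tk x = complexGysin μ hZ hX b (rfl : 2 * j + 2 * 2 = 2 * j + 2 * 2)
      (cupProduct (show 2 * i + 2 * k = 2 * j by omega) (complexBetti.map g (2 * i) x) tk) :=
  rfl

/-- **The push–pull transform** `H̃(Y) → H̃(X)`, `v ↦ b_*(g^*v ∪ t)`, along the correspondence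
`Y ← Z → X` of smooth projective surfaces with twist `t = (t₀, t₂, t₄) ∈ H̃(Z)` — the form of the
cohomological transform of the kernel `𝒪_Γ`, `Γ = (g, b)(Z)`, after Grothendieck–Riemann–Roch for the
embedding `(g, b)` (`t = td(Z) ∪ g^*√td(Y)⁻¹ ∪ b^*√td(X)⁻¹`, module docstring); B–O's "map on cohomology
`H^*(S′, ℤ) → H^*(S, ℤ)` induced by `Φ = β_*α^*`" is the case `t = mckayTwist`.
[cite: BeckmannOberdieck2020, §7.2–7.3] [cite: Huybrechts2016K3, Ch. 16 Remark 3.3] -/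
def pushPullTransform (t : MukaiSpace Z) : MukaiSpace Y →ₗ[ℂ] MukaiSpace X :=
  let π₀ := LinearMap.fst ℂ (complexBetti Y (2 * 0)) (complexBetti Y (2 * 1) × complexBetti Y (2 * 2))
  let π₂ := LinearMap.fst ℂ (complexBetti Y (2 * 1)) (complexBetti Y (2 * 2)) ∘ₗ
    LinearMap.snd ℂ (complexBetti Y (2 * 0)) (complexBetti Y (2 * 1) × complexBetti Y (2 * 2))
  let π₄ := LinearMap.snd ℂ (complexBetti Y (2 * 1)) (complexBetti Y (2 * 2)) ∘ₗ
    LinearMap.snd ℂ (complexBetti Y (2 * 0)) (complexBetti Y (2 * 1) × complexBetti Y (2 * 2))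
  (ppTerm μ hZ hX g b 0 0 0 rfl t.deg0 ∘ₗ π₀).prod
    ((ppTerm μ hZ hX g b 0 1 1 rfl t.deg2 ∘ₗ π₀ + ppTerm μ hZ hX g b 1 0 1 rfl t.deg0 ∘ₗ π₂).prod
      (ppTerm μ hZ hX g b 0 2 2 rfl t.deg4 ∘ₗ π₀ + ppTerm μ hZ hX g b 1 1 2 rfl t.deg2 ∘ₗ π₂ +
        ppTerm μ hZ hX g b 2 0 2 rfl t.deg0 ∘ₗ π₄))

/-- Output degree `0`: `(b_*(g^*v ∪ t))₀ = b_*(g^*v₀ ∪ t₀)`. [cite: BeckmannOberdieck2020, §7.2] -/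
theorem pushPullTransform_deg0 (t : MukaiSpace Z) (v : MukaiSpace Y) :
    (pushPullTransform μ hZ hX g b t v).deg0 = ppTerm μ hZ hX g b 0 0 0 rfl t.deg0 v.deg0 :=
  rfl

/-- Output degree `2`: `(b_*(g^*v ∪ t))₂ = b_*(g^*v₀ ∪ t₂) + b_*(g^*v₂ ∪ t₀)`.
[cite: BeckmannOberdieck2020, §7.2] -/
theorem pushPullTransform_deg2 (t : MukaiSpace Z) (v : MukaiSpace Y) :
    (pushPullTransform μ hZ hX g b t v).deg2 =
      ppTerm μ hZ hX g b 0 1 1 rfl t.deg2 v.deg0 + ppTerm μ hZ hX g b 1 0 1 rfl t.deg0 v.deg2 :=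
  rfl

/-- Output degree `4`: `(b_*(g^*v ∪ t))₄ = b_*(g^*v₀ ∪ t₄) + b_*(g^*v₂ ∪ t₂) + b_*(g^*v₄ ∪ t₀)`.
[cite: BeckmannOberdieck2020, §7.2] -/
theorem pushPullTransform_deg4 (t : MukaiSpace Z) (v : MukaiSpace Y) :
    (pushPullTransform μ hZ hX g b t v).deg4 =
      ppTerm μ hZ hX g b 0 2 2 rfl t.deg4 v.deg0 + ppTerm μ hZ hX g b 1 1 2 rfl t.deg2 v.deg2 +
        ppTerm μ hZ hX g b 2 0 2 rfl t.deg0 v.deg4 :=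
  rfl

/-! ### The Nikulin case: the Todd twist of `Bl₈X` and the cohomological McKay map -/

/-- **The Riemann–Roch twist of the McKay kernel** for a Nikulin involution:
`t_Z = td(Z) · g̃^*√td(Y′)⁻¹ · b^*√td(X)⁻¹ = (1, −½ Σᵢ eᵢ, −ptZ) ∈ H̃(Z)`, `Z = Bl₈X`, in terms of the
eight exceptional classes `eᵢ ∈ H²(Z(ℂ))` and the point class `ptZ ∈ H⁴(Z(ℂ))` (module docstring:
`td(Z) = 1 − ½Σeᵢ + 2ptZ`, `g̃^*(1 − p′) = 1 − 2ptZ`, `b^*(1 − p) = 1 − ptZ`). [folklore]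
[cite: BeckmannOberdieck2020, §7.2] [cite: Huybrechts2016K3, Ch. 9 §1.2 and Ch. 16 Remark 3.3] -/
def mckayTwist (e : Fin 8 → complexBetti Z (2 * 1)) (ptZ : complexBetti Z (2 * 2)) : MukaiSpace Z :=
  (singularCohomology.one ℂ (Motives.ComplexPoints Z), -((2 : ℂ)⁻¹ • ∑ i, e i), -ptZ)

/-- **The cohomological McKay map** `(b_* g̃^*)^H : H̃(Y′) → H̃(X)` of a Nikulin involution: the map on
cohomology induced by the Bridgeland–King–Reid equivalence `Φ = b_* g̃^* : D^b(Y′) → D^b(X)_{⟨ι⟩}`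
followed by the forgetful functor, i.e. the push–pull transform with the Riemann–Roch twist `mckayTwist`
("The map on cohomology `H^*(S′, ℤ) → H^*(S, ℤ)` induced by the composition
`D^b(S′) →Φ D^b(S)_G → D^b(S)`"). [cite: BeckmannOberdieck2020, §7.2–7.3]
[cite: BridgelandKingReid2001, Thm. 1.1] -/
def mckayCohomological (e : Fin 8 → complexBetti Z (2 * 1)) (ptZ : complexBetti Z (2 * 2)) :
    MukaiSpace Y →ₗ[ℂ] MukaiSpace X :=
  pushPullTransform μ hZ hX g b (mckayTwist e ptZ)

/-! ### The Beckmann–Oberdieck table -/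

variable {μ hZ hX g b}
variable {e : Fin 8 → complexBetti Z (2 * 1)} {ptZ : complexBetti Z (2 * 2)} {p : complexBetti X (2 * 2)}

/-- `g̃^* 1 = 1` in the degree spelling `2·0`. [cite: HatcherAT2002, Prop. 3.10] -/
theorem complexBetti_map_one :
    complexBetti.map g (2 * 0) (singularCohomology.one ℂ (Motives.ComplexPoints Y)) =
      singularCohomology.one ℂ (Motives.ComplexPoints Z) :=
  singularCohomology.map_one _

/-- **`1 ↦ 1 − p`**: the McKay map sends the unit of `H̃(Y′)` to `(1, 0, −p)`, granted `b_*1 = 1`,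
`b_*eᵢ = 0` (the exceptional curves are contracted) and `b_*ptZ = p`.
[cite: BeckmannOberdieck2020, §7.3] -/
theorem mckayCohomological_one
    (hb1 : complexGysin μ hZ hX b (rfl : 2 * 0 + 2 * 2 = 2 * 0 + 2 * 2)
      (singularCohomology.one ℂ (Motives.ComplexPoints Z)) =
        singularCohomology.one ℂ (Motives.ComplexPoints X))
    (hbe : ∀ i, complexGysin μ hZ hX b (rfl : 2 * 1 + 2 * 2 = 2 * 1 + 2 * 2) (e i) = 0)
    (hbpt : complexGysin μ hZ hX b (rfl : 2 * 2 + 2 * 2 = 2 * 2 + 2 * 2) ptZ = p) :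
    mckayCohomological μ hZ hX g b e ptZ (MukaiSpace.one Y) = MukaiSpace.one X - MukaiSpace.top p := by
  refine Prod.ext ?_ (Prod.ext ?_ ?_)
  · change (mckayCohomological μ hZ hX g b e ptZ (MukaiSpace.one Y)).deg0 = _
    rw [mckayCohomological, pushPullTransform_deg0, ppTerm_apply]
    simp only [MukaiSpace.one, mckayTwist, MukaiSpace.deg0, MukaiSpace.top, complexBetti_map_one,
      Prod.fst_sub, sub_zero]
    rw [one_cupProduct, hb1]
  · change (mckayCohomological μ hZ hX g b e ptZ (MukaiSpace.one Y)).deg2 = _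
    rw [mckayCohomological, pushPullTransform_deg2, ppTerm_apply, ppTerm_apply]
    simp only [MukaiSpace.one, mckayTwist, MukaiSpace.deg0, MukaiSpace.deg2, MukaiSpace.top,
      complexBetti_map_one, map_zero, LinearMap.zero_apply, add_zero, Prod.snd_sub, Prod.fst_sub, sub_zero]
    rw [one_cupProduct, map_neg, map_smul, map_sum]
    simp only [hbe, Finset.sum_const_zero, smul_zero, neg_zero]
  · change (mckayCohomological μ hZ hX g b e ptZ (MukaiSpace.one Y)).deg4 = _
    rw [mckayCohomological, pushPullTransform_deg4, ppTerm_apply, ppTerm_apply, ppTerm_apply]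
    simp only [MukaiSpace.one, mckayTwist, MukaiSpace.deg0, MukaiSpace.deg2, MukaiSpace.deg4,
      MukaiSpace.top, complexBetti_map_one, map_zero, LinearMap.zero_apply, add_zero, Prod.snd_sub,
      zero_sub]
    rw [one_cupProduct, map_neg, hbpt]

/-- **`p′ ↦ 2p`**: the McKay map sends the point class of `Y′` to twice the point class of `X`, granted
`g̃^*p′ = 2 ptZ` (`deg g̃ = 2`) and `b_*ptZ = p`. [cite: BeckmannOberdieck2020, §7.3] -/
theorem mckayCohomological_top {p' : complexBetti Y (2 * 2)}
    (hgpt : complexBetti.map g (2 * 2) p' = (2 : ℂ) • ptZ)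
    (hbpt : complexGysin μ hZ hX b (rfl : 2 * 2 + 2 * 2 = 2 * 2 + 2 * 2) ptZ = p) :
    mckayCohomological μ hZ hX g b e ptZ (MukaiSpace.top p') = MukaiSpace.top ((2 : ℂ) • p) := by
  refine Prod.ext ?_ (Prod.ext ?_ ?_)
  · change (mckayCohomological μ hZ hX g b e ptZ (MukaiSpace.top p')).deg0 = _
    rw [mckayCohomological, pushPullTransform_deg0, ppTerm_apply]
    simp only [MukaiSpace.top, MukaiSpace.deg0, map_zero, LinearMap.zero_apply]
  · change (mckayCohomological μ hZ hX g b e ptZ (MukaiSpace.top p')).deg2 = _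
    rw [mckayCohomological, pushPullTransform_deg2, ppTerm_apply, ppTerm_apply]
    simp only [MukaiSpace.top, MukaiSpace.deg0, MukaiSpace.deg2, map_zero, LinearMap.zero_apply, add_zero]
  · change (mckayCohomological μ hZ hX g b e ptZ (MukaiSpace.top p')).deg4 = _
    rw [mckayCohomological, pushPullTransform_deg4, ppTerm_apply, ppTerm_apply, ppTerm_apply]
    simp only [MukaiSpace.top, mckayTwist, MukaiSpace.deg0, MukaiSpace.deg2, MukaiSpace.deg4, map_zero,
      LinearMap.zero_apply, zero_add, hgpt, map_smul, LinearMap.smul_apply]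
    rw [cupProduct_one, hbpt]

/-- **`Nᵢ ↦ p`**: the McKay map sends the class of a nodal curve `N = Nᵢ ⊂ Y′` to the point class of
`X`, granted `g̃^*N = 2eᵢ` (`g̃` is branched along `Eᵢ^Z ≅ Nᵢ`), `b_*eⱼ = 0`, `eᵢ² = −ptZ`,
`eᵢ ∪ eⱼ = 0` (`j ≠ i`) and `b_*ptZ = p`; hence `δ = ½ΣNᵢ ↦ 4p`. [cite: BeckmannOberdieck2020, §7.3] -/
theorem mckayCohomological_nodal {N : complexBetti Y (2 * 1)} {i : Fin 8}
    (hgN : complexBetti.map g (2 * 1) N = (2 : ℂ) • e i)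
    (hbe : ∀ j, complexGysin μ hZ hX b (rfl : 2 * 1 + 2 * 2 = 2 * 1 + 2 * 2) (e j) = 0)
    (hee : cupProduct mukaiDeg_two_two (e i) (e i) = -ptZ)
    (heij : ∀ j, j ≠ i → cupProduct mukaiDeg_two_two (e i) (e j) = 0)
    (hbpt : complexGysin μ hZ hX b (rfl : 2 * 2 + 2 * 2 = 2 * 2 + 2 * 2) ptZ = p) :
    mckayCohomological μ hZ hX g b e ptZ
        ((0 : complexBetti Y (2 * 0)), N, (0 : complexBetti Y (2 * 2))) = MukaiSpace.top p := by
  have key : cupProduct mukaiDeg_two_two ((2 : ℂ) • e i) (-((2 : ℂ)⁻¹ • ∑ j, e j)) = ptZ := by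
    rw [map_smul, LinearMap.smul_apply, map_neg, map_smul, map_sum,
      Finset.sum_eq_single i (fun j _ hj ↦ heij j hj) (fun h ↦ (h (Finset.mem_univ i)).elim), hee]
    simp [smul_smul]
  refine Prod.ext ?_ (Prod.ext ?_ ?_)
  · change (mckayCohomological μ hZ hX g b e ptZ (0, N, 0)).deg0 = _
    rw [mckayCohomological, pushPullTransform_deg0, ppTerm_apply]
    simp only [MukaiSpace.top, MukaiSpace.deg0, map_zero, LinearMap.zero_apply]
  · change (mckayCohomological μ hZ hX g b e ptZ (0, N, 0)).deg2 = _
    rw [mckayCohomological, pushPullTransform_deg2, ppTerm_apply, ppTerm_apply]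
    simp only [MukaiSpace.top, mckayTwist, MukaiSpace.deg0, MukaiSpace.deg2, map_zero,
      LinearMap.zero_apply, zero_add, hgN, map_smul, LinearMap.smul_apply]
    rw [cupProduct_one, hbe, smul_zero]
  · change (mckayCohomological μ hZ hX g b e ptZ (0, N, 0)).deg4 = _
    rw [mckayCohomological, pushPullTransform_deg4, ppTerm_apply, ppTerm_apply, ppTerm_apply]
    simp only [MukaiSpace.top, mckayTwist, MukaiSpace.deg0, MukaiSpace.deg2, MukaiSpace.deg4, map_zero,
      LinearMap.zero_apply, zero_add, add_zero, hgN]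
    rw [key, hbpt]

/-- **`D ↦ g^*D` on `N^⊥`**: for a class `D ∈ H²(Y′(ℂ))` whose pull-back is orthogonal to the
exceptional classes (`g̃^*D ∪ eⱼ = 0`, i.e. `D ⊥ Nⱼ`), the McKay map is the degree-`2` correspondence
`g^* := b_* g̃^*` with no correction terms (B–O's `C′ ↦ 2H`, `C′₁ = ½C′ − ½(E₁+E₂) ↦ H − p`).
[cite: BeckmannOberdieck2020, §7.3] -/
theorem mckayCohomological_perp {D : complexBetti Y (2 * 1)}
    (hD : ∀ j, cupProduct mukaiDeg_two_two (complexBetti.map g (2 * 1) D) (e j) = 0) :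
    mckayCohomological μ hZ hX g b e ptZ ((0 : complexBetti Y (2 * 0)), D, (0 : complexBetti Y (2 * 2))) =
      ((0 : complexBetti X (2 * 0)),
        complexGysin μ hZ hX b (rfl : 2 * 1 + 2 * 2 = 2 * 1 + 2 * 2) (complexBetti.map g (2 * 1) D),
        (0 : complexBetti X (2 * 2))) := by
  have key : cupProduct mukaiDeg_two_two (complexBetti.map g (2 * 1) D) (-((2 : ℂ)⁻¹ • ∑ j, e j)) = 0 := by
    rw [map_neg, map_smul, map_sum]
    simp only [hD, Finset.sum_const_zero, smul_zero, neg_zero]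
  refine Prod.ext ?_ (Prod.ext ?_ ?_)
  · change (mckayCohomological μ hZ hX g b e ptZ (0, D, 0)).deg0 = _
    rw [mckayCohomological, pushPullTransform_deg0, ppTerm_apply]
    simp only [MukaiSpace.deg0, map_zero, LinearMap.zero_apply]
  · change (mckayCohomological μ hZ hX g b e ptZ (0, D, 0)).deg2 = _
    rw [mckayCohomological, pushPullTransform_deg2, ppTerm_apply, ppTerm_apply]
    simp only [mckayTwist, MukaiSpace.deg0, MukaiSpace.deg2, map_zero, LinearMap.zero_apply, zero_add]
    rw [cupProduct_one]
  · change (mckayCohomological μ hZ hX g b e ptZ (0, D, 0)).deg4 = _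
    rw [mckayCohomological, pushPullTransform_deg4, ppTerm_apply, ppTerm_apply, ppTerm_apply]
    simp only [mckayTwist, MukaiSpace.deg0, MukaiSpace.deg2, MukaiSpace.deg4, map_zero,
      LinearMap.zero_apply, zero_add, add_zero]
    rw [key, map_zero]

end PushPull

end Literature.AlgebraicGeometry.Surfaces

end
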